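import Mathlib
import Summits.AtomisticToContinuum.HydrodynamicLimit.Theorems.ImplosionDichotomyDenseExcursionCavityCentreBranch
import Summits.AtomisticToContinuum.HydrodynamicLimit.Theorems.ImplosionDichotomyDenseExcursionCavityCentreUnique

/-!
# Gluing toolkit for the matching step of the cavity resolvent (theorem T6)
# (crux `DenseExcursion`, line `sonic-cavity-renewal`, bricks for stub `stub_cavityResolventCk`)

Helper file (`--supports stmt-AtomisticToContinuum-12586`, line lead a2, stub-worker E1 for `stub_cavityResolventCk`,
theorem T6 of its decomposition: matching of the centre-regular branch, the smooth branch at the sonic point and the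
exterior continuation). The resolvent equation `Λŵ − linW = f`, `Λŝ − linS = g` (`…R2Modes`) is a regular linear
`2 × 2` system off the sonic point `x = 0` (for a monatomic profile in the cavity tube `W − 1 ± S ≠ 0` on `x ≠ 0`:
`noncharacteristic_of_neg`, `noncharacteristic_of_pos`), so solutions on overlapping open intervals agreeing at one
point agree on the overlap (`eqOn_of_solutions`). This file packages the gluing steps used by the matching argument:

* `glue_solutions` (registered) — GENERIC GLUE: a `C^∞` solution on `(−∞, β)` and a `C^∞` solution on `(α, β')`
  (`α < t₀ < β ≤ β'`, `(α, β)` non-characteristic) with the same value at `t₀` glue (`if x ≤ t₀ then left else right`)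
  to a `C^∞` solution on `(−∞, β')` which is the left piece on `(−∞, β)` and the right piece on `(α, β')`;
* `regularize_cutoff` — a `C^∞` solution on `(−∞, b)` whose germ at the centre is that of a regular pair becomes,
  after a smooth cut-off beyond `b' < b`, a REGULAR PAIR (`IsRegularPair`) solving on `(−∞, b']`;
* `extend_regular_left` — a regular pair solving on `x ≤ c` (`c ≤ d < 0`) is continued to a regular pair solving on
  `x ≤ d` (transport `exists_solution_segment` on `[c − 1, d/2]`, glue, cut-off);
* `extend_right_global` — a `C^∞` solution on `(−∞, δ)` (`0 < δ ≤ 1`) with a regular germ at the centre is continued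
  to a regular pair solving on ALL of `ℝ` (transport on `[δ/2, 2]`, glue, cut-off beyond `1`, `exterior_continuation`);
* `glue_centre_sonic` (registered) — THE MATCHING GLUE: a regular pair solving on `x ≤ −δ/4` and a `C^∞` solution on
  `(−δ, δ)` with the same value at `x* = −δ/2` glue to a regular pair solving on `ℝ`, equal to the left piece on
  `x < −δ/4` and to the right piece on `(−δ, δ)`;
* `exists_ne_zero_lt` — a regular solution of the homogeneous equations on `x ≤ −X`, non-trivial there, is non-trivial
  at some `x < −X` (`homogeneous_eq_zero_of_zero`).

Sources: folklore (Hartman, *Ordinary Differential Equations*, Ch. IV Lemma 1.1: uniqueness and continuation for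
regular linear systems). Everything proved; no new definitions.
-/

noncomputable section

open Set Filter
open scoped Topology ContDiff

namespace Summit.AtomisticToContinuum.HydrodynamicLimit.Theorems.SonicCavityRenewal

open Summit.AtomisticToContinuum.HydrodynamicLimit.Theorems.R2OneModeTwoConditions

/-! ## The characteristic speeds do not vanish off the sonic point -/

/-- On `x < 0` both characteristic speeds are non-zero: `W + S > 1` (tube (a)), `|W| ≤ 1/4` (tube (c)) and `S > 0`.
[folklore] -/
theorem noncharacteristic_of_neg {r : ℝ} {W S : ℝ → ℝ} (hP : IsMonatomicProfile r W S) (hT : CavityTube r W S) :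
    ∀ x, x < 0 → W x - 1 + S x ≠ 0 ∧ W x - 1 - S x ≠ 0 := by
  obtain ⟨-, -, -, -, hSpos, -⟩ := hP
  obtain ⟨-, hsup, -, -, -, -, -, hWenv, -⟩ := hT
  intro x hx
  have h1 := hsup x hx
  have h2 := (abs_le.1 (hWenv x (by linarith)).1).2
  have h3 := hSpos x
  exact ⟨(by linarith : 0 < W x - 1 + S x).ne', (by linarith : W x - 1 - S x < 0).ne⟩

/-- On `x > 0` both characteristic speeds are non-zero (negative): `W + S < 1` (tube (a)) and `S > 0`. [folklore] -/
theorem noncharacteristic_of_pos {r : ℝ} {W S : ℝ → ℝ} (hP : IsMonatomicProfile r W S) (hT : CavityTube r W S) :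
    ∀ x, 0 < x → W x - 1 + S x ≠ 0 ∧ W x - 1 - S x ≠ 0 := by
  obtain ⟨-, -, -, -, hSpos, -⟩ := hP
  obtain ⟨-, -, hsub, -⟩ := hT
  intro x hx
  have h1 := hsub x hx
  have h3 := hSpos x
  exact ⟨(by linarith : W x - 1 + S x < 0).ne, (by linarith : W x - 1 - S x < 0).ne⟩

/-! ## The generic glue of two solutions on overlapping open intervals -/

/-- **Registered helper `glue_solutions`: GLUING TWO SOLUTIONS OF THE RESOLVENT EQUATION ON OVERLAPPING OPEN
INTERVALS.** For `C^∞` profile functions, `α < t₀ < β ≤ β'` with `W − 1 ± S ≠ 0` on `(α, β)`, a `C^∞` solution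
`(u, v)` on `(−∞, β)` and a `C^∞` solution `(u', v')` on `(α, β')` of `Λŵ − linW = f`, `Λŝ − linS = g` with
`(u, v)(t₀) = (u', v')(t₀)`: there is a `C^∞` solution on `(−∞, β')` equal to `(u, v)` on `(−∞, β)` and to `(u', v')`
on `(α, β')` (the two pieces agree on `(α, β)` by `eqOn_of_solutions`; the glue `if x ≤ t₀ then u else u'` is locally
one of them everywhere). [folklore] -/
theorem glue_solutions : ∀ (r : ℝ) (W S : ℝ → ℝ), ContDiff ℝ ∞ W → ContDiff ℝ ∞ S → ∀ (Λ : ℂ) (f g u v u' v' : ℝ → ℂ) (α t₀ β β' : ℝ), α < t₀ → t₀ < β → β ≤ β' → (∀ x ∈ Set.Ioo α β, W x - 1 + S x ≠ 0 ∧ W x - 1 - S x ≠ 0) → ContDiffOn ℝ ∞ u (Set.Iio β) → ContDiffOn ℝ ∞ v (Set.Iio β) → ContDiffOn ℝ ∞ u' (Set.Ioo α β') → ContDiffOn ℝ ∞ v' (Set.Ioo α β') → (∀ x ∈ Set.Iio β, Λ * u x - linW r W S u v x = f x ∧ Λ * v x - linS r W S u v x = g x) → (∀ x ∈ Set.Ioo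 α β', Λ * u' x - linW r W S u' v' x = f x ∧ Λ * v' x - linS r W S u' v' x = g x) → u t₀ = u' t₀ → v t₀ = v' t₀ → ∃ U V : ℝ → ℂ, ContDiffOn ℝ ∞ U (Set.Iio β') ∧ ContDiffOn ℝ ∞ V (Set.Iio β') ∧ (∀ x ∈ Set.Iio β', Λ * U x - linW r W S U V x = f x ∧ Λ * V x - linS r W S U V x = g x) ∧ Set.EqOn U u (Set.Iio β) ∧ Set.EqOn V v (Set.Iio β) ∧ Set.EqOn U u' (Set.Ioo α β') ∧ Set.EqOn V v' (Set.Ioo α β') := by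
  intro r W S hW hS Λ f g u v u' v' α t₀ β β' hαt htβ hββ' hnc hu hv hu' hv' hsol hsol' h0 h0'
  -- the two pieces agree on the overlap `(α, β)`
  have hdu : ∀ x ∈ Ioo α β, DifferentiableAt ℝ u x ∧ DifferentiableAt ℝ v x := fun x hx =>
    ⟨(hu.differentiableOn (by simp)).differentiableAt (Iio_mem_nhds hx.2),
      (hv.differentiableOn (by simp)).differentiableAt (Iio_mem_nhds hx.2)⟩
  have hdu' : ∀ x ∈ Ioo α β, DifferentiableAt ℝ u' x ∧ DifferentiableAt ℝ v' x := fun x hx =>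
    ⟨(hu'.differentiableOn (by simp)).differentiableAt (Ioo_mem_nhds hx.1 (lt_of_lt_of_le hx.2 hββ')),
      (hv'.differentiableOn (by simp)).differentiableAt (Ioo_mem_nhds hx.1 (lt_of_lt_of_le hx.2 hββ'))⟩
  obtain ⟨equ, eqv⟩ := eqOn_of_solutions (r := r) hW hS (t₀ := t₀) ⟨hαt, htβ⟩ hnc (Λ := Λ) (f := f) (g := g)
    hdu hdu' (fun x hx => hsol x hx.2) (fun x hx => hsol' x ⟨hx.1, lt_of_lt_of_le hx.2 hββ'⟩) h0 h0'
  set U : ℝ → ℂ := fun x => if x ≤ t₀ then u x else u' x with hU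
  set V : ℝ → ℂ := fun x => if x ≤ t₀ then v x else v' x with hV
  have eU : EqOn U u (Iio β) := fun x hx => by
    by_cases h : x ≤ t₀
    · simp only [hU, if_pos h]
    · simp only [hU, if_neg h]; exact (equ ⟨by linarith [not_le.1 h], hx⟩).symm
  have eV : EqOn V v (Iio β) := fun x hx => by
    by_cases h : x ≤ t₀
    · simp only [hV, if_pos h]
    · simp only [hV, if_neg h]; exact (eqv ⟨by linarith [not_le.1 h], hx⟩).symm
  have eU' : EqOn U u' (Ioo α β') := fun x hx => by
    by_cases h : x ≤ t₀
    · simp only [hU, if_pos h]; exact equ ⟨hx.1, lt_of_le_of_lt h htβ⟩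
    · simp only [hU, if_neg h]
  have eV' : EqOn V v' (Ioo α β') := fun x hx => by
    by_cases h : x ≤ t₀
    · simp only [hV, if_pos h]; exact eqv ⟨hx.1, lt_of_le_of_lt h htβ⟩
    · simp only [hV, if_neg h]
  -- every point of `(−∞, β')` has a neighbourhood on which the glue is one of the two pieces
  have germ : ∀ x, x < β' → (U =ᶠ[𝓝 x] u ∧ V =ᶠ[𝓝 x] v ∧ x < β) ∨
      (U =ᶠ[𝓝 x] u' ∧ V =ᶠ[𝓝 x] v' ∧ x ∈ Ioo α β') := by
    intro x hx
    rcases lt_or_ge x β with hxβ | hxβ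
    · exact Or.inl ⟨eU.eventuallyEq_of_mem (Iio_mem_nhds hxβ), eV.eventuallyEq_of_mem (Iio_mem_nhds hxβ), hxβ⟩
    · have hxI : x ∈ Ioo α β' := ⟨by linarith, hx⟩
      exact Or.inr ⟨eU'.eventuallyEq_of_mem (Ioo_mem_nhds hxI.1 hxI.2),
        eV'.eventuallyEq_of_mem (Ioo_mem_nhds hxI.1 hxI.2), hxI⟩
  refine ⟨U, V, fun x hx => ?_, fun x hx => ?_, fun x hx => ?_, eU, eV, eU', eV'⟩
  · rcases germ x hx with ⟨e1, -, hxβ⟩ | ⟨e1, -, hxI⟩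
    · exact ((hu.contDiffAt (Iio_mem_nhds hxβ)).congr_of_eventuallyEq e1).contDiffWithinAt
    · exact ((hu'.contDiffAt (Ioo_mem_nhds hxI.1 hxI.2)).congr_of_eventuallyEq e1).contDiffWithinAt
  · rcases germ x hx with ⟨-, e2, hxβ⟩ | ⟨-, e2, hxI⟩
    · exact ((hv.contDiffAt (Iio_mem_nhds hxβ)).congr_of_eventuallyEq e2).contDiffWithinAt
    · exact ((hv'.contDiffAt (Ioo_mem_nhds hxI.1 hxI.2)).congr_of_eventuallyEq e2).contDiffWithinAt
  · rcases germ x hx with ⟨e1, e2, hxβ⟩ | ⟨e1, e2, hxI⟩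
    · obtain ⟨h1, h2⟩ := lin_congr_of_eventuallyEq (r := r) (W := W) (S := S) e1 e2
      rw [h1, h2, e1.eq_of_nhds, e2.eq_of_nhds]
      exact hsol x hxβ
    · obtain ⟨h1, h2⟩ := lin_congr_of_eventuallyEq (r := r) (W := W) (S := S) e1 e2
      rw [h1, h2, e1.eq_of_nhds, e2.eq_of_nhds]
      exact hsol' x hxI

/-! ## Smooth cut-off: from a solution with a regular germ to a regular pair -/

/-- **CUT-OFF.** A `C^∞` solution `(u, v)` of the resolvent equation on `(−∞, b)` which agrees on some `(−∞, m)` with a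
regular pair becomes, after multiplication by a smooth cut-off equal to `1` on `x ≤ (2b' + b)/3` and to `0` on
`x ≥ (b' + 2b)/3` (`b' < b`), a REGULAR PAIR solving the equation on `x ≤ b'` and equal to `(u, v)` there
(`isRegularPair_of_eqOn`: regularity is a germ condition at the centre). [folklore] -/
theorem regularize_cutoff {r : ℝ} {W S : ℝ → ℝ} {Λ : ℂ} {f g u v ŵ₀ ŝ₀ : ℝ → ℂ} {m b b' : ℝ} (hb : b' < b)
    (h₀ : IsRegularPair ŵ₀ ŝ₀) (hu : ContDiffOn ℝ ∞ u (Iio b)) (hv : ContDiffOn ℝ ∞ v (Iio b))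
    (hequ : EqOn u ŵ₀ (Iio m)) (heqv : EqOn v ŝ₀ (Iio m))
    (hsol : ∀ x ∈ Iio b, Λ * u x - linW r W S u v x = f x ∧ Λ * v x - linS r W S u v x = g x) :
    ∃ ŵ ŝ : ℝ → ℂ, IsRegularPair ŵ ŝ ∧
      (∀ x ∈ Iic b', Λ * ŵ x - linW r W S ŵ ŝ x = f x ∧ Λ * ŝ x - linS r W S ŵ ŝ x = g x) ∧
      EqOn ŵ u (Iic b') ∧ EqOn ŝ v (Iic b') := by
  set a'' : ℝ := (2 * b' + b) / 3 with ha''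
  set b'' : ℝ := (b' + 2 * b) / 3 with hb''
  have h1 : b' < a'' := by rw [ha'']; linarith
  have h2 : a'' < b'' := by rw [ha'', hb'']; linarith
  have h3 : b'' < b := by rw [hb'']; linarith
  set ψ : ℝ → ℝ := fun x => Real.smoothTransition ((b'' - x) / (b'' - a'')) with hψ
  have hψs : ContDiff ℝ ∞ ψ :=
    Real.smoothTransition.contDiff.comp ((contDiff_const.sub contDiff_id).div_const _)
  have hψ1 : ∀ x, x ≤ a'' → ψ x = 1 := fun x hx =>
    Real.smoothTransition.one_of_one_le (by rw [le_div_iff₀ (by linarith)]; linarith)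
  have hψ0 : ∀ x, b'' ≤ x → ψ x = 0 := fun x hx =>
    Real.smoothTransition.zero_of_nonpos (div_nonpos_of_nonpos_of_nonneg (by linarith) (by linarith))
  set ŵ : ℝ → ℂ := fun x => (ψ x : ℂ) * u x with hŵ
  set ŝ : ℝ → ℂ := fun x => (ψ x : ℂ) * v x with hŝ
  have hfar : ∀ x, b'' < x → ŵ =ᶠ[𝓝 x] (fun _ => 0) ∧ ŝ =ᶠ[𝓝 x] (fun _ => 0) := by
    intro x hx
    constructor <;> filter_upwards [Ioi_mem_nhds hx] with y hy <;>
      simp only [hŵ, hŝ, hψ0 y (le_of_lt hy), Complex.ofReal_zero, zero_mul]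
  have hnear : ∀ x, x < a'' → ŵ =ᶠ[𝓝 x] u ∧ ŝ =ᶠ[𝓝 x] v := by
    intro x hx
    constructor <;> filter_upwards [Iio_mem_nhds hx] with y hy <;>
      simp only [hŵ, hŝ, hψ1 y (le_of_lt hy), Complex.ofReal_one, one_mul]
  have hψC : ContDiff ℝ ∞ (fun x => (ψ x : ℂ)) := Complex.ofRealCLM.contDiff.comp hψs
  have hŵs : ContDiff ℝ ∞ ŵ := contDiff_iff_contDiffAt.2 fun x => by
    rcases lt_or_ge x b with hxb | hxb
    · exact hψC.contDiffAt.mul (hu.contDiffAt (Iio_mem_nhds hxb))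
    · exact contDiffAt_const.congr_of_eventuallyEq (hfar x (by linarith)).1
  have hŝs : ContDiff ℝ ∞ ŝ := contDiff_iff_contDiffAt.2 fun x => by
    rcases lt_or_ge x b with hxb | hxb
    · exact hψC.contDiffAt.mul (hv.contDiffAt (Iio_mem_nhds hxb))
    · exact contDiffAt_const.congr_of_eventuallyEq (hfar x (by linarith)).2
  have hagree : EqOn ŵ ŵ₀ (Iio (min m a'')) ∧ EqOn ŝ ŝ₀ (Iio (min m a'')) := by
    constructor <;> intro x hx
    · have hx1 : x < a'' := lt_of_lt_of_le hx (min_le_right _ _)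
      have hx2 : x < m := lt_of_lt_of_le hx (min_le_left _ _)
      simp only [hŵ, hψ1 x hx1.le, Complex.ofReal_one, one_mul]
      exact hequ hx2
    · have hx1 : x < a'' := lt_of_lt_of_le hx (min_le_right _ _)
      have hx2 : x < m := lt_of_lt_of_le hx (min_le_left _ _)
      simp only [hŝ, hψ1 x hx1.le, Complex.ofReal_one, one_mul]
      exact heqv hx2
  refine ⟨ŵ, ŝ, isRegularPair_of_eqOn ŵ₀ ŝ₀ ŵ ŝ _ h₀ hŵs hŝs hagree.1 hagree.2, fun x hx => ?_, fun x hx => ?_,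
    fun x hx => ?_⟩
  · have hxa : x < a'' := lt_of_le_of_lt hx h1
    obtain ⟨e1, e2⟩ := hnear x hxa
    obtain ⟨l1, l2⟩ := lin_congr_of_eventuallyEq (r := r) (W := W) (S := S) e1 e2
    rw [l1, l2, e1.eq_of_nhds, e2.eq_of_nhds]
    exact hsol x (show x < b by linarith [show x ≤ b' from hx])
  · show (ψ x : ℂ) * u x = u x
    rw [hψ1 x (by linarith [show x ≤ b' from hx]), Complex.ofReal_one, one_mul]
  · show (ψ x : ℂ) * v x = v x
    rw [hψ1 x (by linarith [show x ≤ b' from hx]), Complex.ofReal_one, one_mul]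

/-! ## Continuation of regular solutions -/

/-- **CONTINUATION TO THE LEFT OF THE SONIC POINT.** For a monatomic profile in the cavity tube, `Λ : ℂ`, `C^∞` sources
and a regular pair solving the resolvent equation on `x ≤ c`, with `c ≤ d < 0`: there is a regular pair solving it on
`x ≤ d` and equal to the given one on `x < c` (transport on the non-characteristic segment `[c − 1, d/2]` through the
datum at `c − 1/2`, glue, smooth cut-off beyond `d`). [folklore] -/
theorem extend_regular_left {r : ℝ} {W S : ℝ → ℝ} (hP : IsMonatomicProfile r W S) (hT : CavityTube r W S) (Λ : ℂ)
    {f g : ℝ → ℂ} (hf : ContDiff ℝ ∞ f) (hg : ContDiff ℝ ∞ g) {ŵ₀ ŝ₀ : ℝ → ℂ} (h₀ : IsRegularPair ŵ₀ ŝ₀)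
    {c d : ℝ} (hcd : c ≤ d) (hd : d < 0)
    (hsol : ∀ x ∈ Iic c, Λ * ŵ₀ x - linW r W S ŵ₀ ŝ₀ x = f x ∧ Λ * ŝ₀ x - linS r W S ŵ₀ ŝ₀ x = g x) :
    ∃ ŵ ŝ : ℝ → ℂ, IsRegularPair ŵ ŝ ∧
      (∀ x ∈ Iic d, Λ * ŵ x - linW r W S ŵ ŝ x = f x ∧ Λ * ŝ x - linS r W S ŵ ŝ x = g x) ∧
      EqOn ŵ ŵ₀ (Iio c) ∧ EqOn ŝ ŝ₀ (Iio c) := by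
  have hW : ContDiff ℝ ∞ W := hP.2.2.1
  have hS : ContDiff ℝ ∞ S := hP.2.2.2.1
  have hnc := noncharacteristic_of_neg hP hT
  obtain ⟨ŵ₁, ŝ₁, hŵ₁, hŝ₁, -, h10, h10', hsol₁⟩ := exists_solution_segment (r := r) hW hS (a := c - 1) (b := d / 2)
    (by linarith) (fun x hx => hnc x (by linarith [hx.2])) Λ hf hg (c - 1 / 2) (ŵ₀ (c - 1 / 2)) (ŝ₀ (c - 1 / 2))
  obtain ⟨U, V, hU, hV, hsolU, eU, eV, -, -⟩ := glue_solutions r W S hW hS Λ f g ŵ₀ ŝ₀ ŵ₁ ŝ₁ (c - 1) (c - 1 / 2) c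
    (d / 2) (by linarith) (by linarith) (by linarith) (fun x hx => hnc x (by linarith [hx.2])) h₀.1.contDiffOn
    h₀.2.1.contDiffOn hŵ₁ hŝ₁ (fun x (hx : x < c) => hsol x (show x ≤ c from hx.le))
    (fun x hx => hsol₁ x (Ioo_subset_Icc_self hx))
    h10.symm h10'.symm
  obtain ⟨ŵ, ŝ, hreg, hsolw, ew, es⟩ := regularize_cutoff (b := d / 2) (b' := d) (m := c) (by linarith) h₀ hU hV eU eV
    hsolU
  exact ⟨ŵ, ŝ, hreg, hsolw, fun x hx => (ew (show x ≤ d by linarith [show x < c from hx])).trans (eU hx),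
    fun x hx => (es (show x ≤ d by linarith [show x < c from hx])).trans (eV hx)⟩

/-- **CONTINUATION THROUGH THE EXTERIOR.** For a monatomic profile in the cavity tube, `Λ : ℂ`, `C^∞` sources,
`0 < δ ≤ 1` and a `C^∞` solution `(u, v)` of the resolvent equation on `(−∞, δ)` which agrees on some `(−∞, m)` with a
regular pair: there is a regular pair solving the equation on ALL of `ℝ` and equal to `(u, v)` on `(−∞, δ)` (transport on
`[δ/2, 2]`, glue at `3δ/4`, cut-off beyond `1`, `exterior_continuation`). [folklore] -/
theorem extend_right_global {r : ℝ} {W S : ℝ → ℝ} (hP : IsMonatomicProfile r W S) (hT : CavityTube r W S) (Λ : ℂ)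
    {f g : ℝ → ℂ} (hf : ContDiff ℝ ∞ f) (hg : ContDiff ℝ ∞ g) {δ : ℝ} (hδ : 0 < δ) (hδ1 : δ ≤ 1)
    {u v ŵ₀ ŝ₀ : ℝ → ℂ} {m : ℝ} (h₀ : IsRegularPair ŵ₀ ŝ₀) (hequ : EqOn u ŵ₀ (Iio m)) (heqv : EqOn v ŝ₀ (Iio m))
    (hu : ContDiffOn ℝ ∞ u (Iio δ)) (hv : ContDiffOn ℝ ∞ v (Iio δ))
    (hsol : ∀ x ∈ Iio δ, Λ * u x - linW r W S u v x = f x ∧ Λ * v x - linS r W S u v x = g x) :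
    ∃ ŵ ŝ : ℝ → ℂ, IsRegularPair ŵ ŝ ∧
      (∀ x, Λ * ŵ x - linW r W S ŵ ŝ x = f x ∧ Λ * ŝ x - linS r W S ŵ ŝ x = g x) ∧
      EqOn ŵ u (Iio δ) ∧ EqOn ŝ v (Iio δ) := by
  have hW : ContDiff ℝ ∞ W := hP.2.2.1
  have hS : ContDiff ℝ ∞ S := hP.2.2.2.1
  have hnc := noncharacteristic_of_pos hP hT
  obtain ⟨ŵ₁, ŝ₁, hŵ₁, hŝ₁, -, h10, h10', hsol₁⟩ := exists_solution_segment (r := r) hW hS (a := δ / 2) (b := 2)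
    (by linarith) (fun x hx => hnc x (by linarith [hx.1])) Λ hf hg (3 * δ / 4) (u (3 * δ / 4)) (v (3 * δ / 4))
  obtain ⟨U, V, hU, hV, hsolU, eU, eV, -, -⟩ := glue_solutions r W S hW hS Λ f g u v ŵ₁ ŝ₁ (δ / 2) (3 * δ / 4) δ 2
    (by linarith) (by linarith) (by linarith) (fun x hx => hnc x (by linarith [hx.1])) hu hv hŵ₁ hŝ₁ hsol
    (fun x hx => hsol₁ x (Ioo_subset_Icc_self hx)) h10.symm h10'.symm
  obtain ⟨ŵ₂, ŝ₂, hreg₂, hsol₂, e₂, e₂'⟩ := regularize_cutoff (b := 2) (b' := 1) (m := min m δ) (by norm_num) h₀ hU hV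
    (fun x (hx : x < min m δ) => (eU (show x < δ from lt_of_lt_of_le hx (min_le_right _ _))).trans
      (hequ (show x < m from lt_of_lt_of_le hx (min_le_left _ _))))
    (fun x (hx : x < min m δ) => (eV (show x < δ from lt_of_lt_of_le hx (min_le_right _ _))).trans
      (heqv (show x < m from lt_of_lt_of_le hx (min_le_left _ _))))
    hsolU
  obtain ⟨ŵ, ŝ, hreg, hsolw, ew, es⟩ := exterior_continuation r W S hP hT Λ f g ŵ₂ ŝ₂ hf hg hreg₂ hsol₂
  refine ⟨ŵ, ŝ, hreg, hsolw, fun x hx => ?_, fun x hx => ?_⟩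
  · have hx1 : x ∈ Iic (1 : ℝ) := show x ≤ 1 by linarith [show x < δ from hx]
    rw [ew hx1, e₂ hx1, eU hx]
  · have hx1 : x ∈ Iic (1 : ℝ) := show x ≤ 1 by linarith [show x < δ from hx]
    rw [es hx1, e₂' hx1, eV hx]

/-- **Registered helper `glue_centre_sonic`: THE MATCHING GLUE.** For a monatomic profile in the cavity tube, `Λ : ℂ`,
`C^∞` sources, `0 < δ ≤ 1`, a regular pair `(uL, vL)` solving the resolvent equation on `x ≤ −δ/4` and a `C^∞` solution
`(uR, vR)` on `(−δ, δ)` with `(uL, vL)(−δ/2) = (uR, vR)(−δ/2)`: there is a regular pair solving the equation on all of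
`ℝ`, equal to `(uL, vL)` on `x < −δ/4` and to `(uR, vR)` on `(−δ, δ)`. [folklore] -/
theorem glue_centre_sonic : ∀ (r : ℝ) (W S : ℝ → ℝ), IsMonatomicProfile r W S → CavityTube r W S → ∀ (Λ : ℂ) (f g : ℝ → ℂ), ContDiff ℝ ∞ f → ContDiff ℝ ∞ g → ∀ (δ : ℝ), 0 < δ → δ ≤ 1 → ∀ (uL vL uR vR : ℝ → ℂ), IsRegularPair uL vL → (∀ x ∈ Set.Iic (-(δ / 4)), Λ * uL x - linW r W S uL vL x = f x ∧ Λ * vL x - linS r W S uL vL x = g x) → ContDiffOn ℝ ∞ uR (Set.Ioo (-δ) δ) → ContDiffOn ℝ ∞ vR (Set.Ioo (-δ) δ) → (∀ x ∈ Set.Ioo (-δ) δ, Λ * uR x - linW r W S uR vR x = f x ∧ Λ * vR x - linS r W S uR vR x = g x) → uL (-(δ / 2)) = uR (-(δ / 2)) → vL (-(δ / 2)) = vR (-(δ / 2)) → ∃ ŵ ŝ : ℝ → ℂ, IsRegularPair ŵ ŝ ∧ (∀ x, Λ * ŵ x - linW r W S ŵ ŝ x = f x ∧ Λ * ŝ x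 - linS r W S ŵ ŝ x = g x) ∧ Set.EqOn ŵ uL (Set.Iio (-(δ / 4))) ∧ Set.EqOn ŝ vL (Set.Iio (-(δ / 4))) ∧ Set.EqOn ŵ uR (Set.Ioo (-δ) δ) ∧ Set.EqOn ŝ vR (Set.Ioo (-δ) δ) := by
  intro r W S hP hT Λ f g hf hg δ hδ hδ1 uL vL uR vR hL hsolL huR hvR hsolR h1 h2
  have hW : ContDiff ℝ ∞ W := hP.2.2.1
  have hS : ContDiff ℝ ∞ S := hP.2.2.2.1
  have hnc := noncharacteristic_of_neg hP hT
  obtain ⟨U, V, hU, hV, hsolU, eU, eV, eU', eV'⟩ := glue_solutions r W S hW hS Λ f g uL vL uR vR (-δ) (-(δ / 2))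
    (-(δ / 4)) δ (by linarith) (by linarith) (by linarith) (fun x hx => hnc x (by linarith [hx.2])) hL.1.contDiffOn
    hL.2.1.contDiffOn huR hvR (fun x (hx : x < -(δ / 4)) => hsolL x (show x ≤ -(δ / 4) from hx.le)) hsolR h1 h2
  obtain ⟨ŵ, ŝ, hreg, hsol, ew, es⟩ := extend_right_global hP hT Λ hf hg hδ hδ1 hL (m := -(δ / 4)) eU eV hU hV hsolU
  refine ⟨ŵ, ŝ, hreg, hsol, fun x hx => ?_, fun x hx => ?_, fun x hx => (ew hx.2).trans (eU' hx),
    fun x hx => (es hx.2).trans (eV' hx)⟩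
  · exact (ew (show x < δ by linarith [show x < -(δ / 4) from hx])).trans (eU hx)
  · exact (es (show x < δ by linarith [show x < -(δ / 4) from hx])).trans (eV hx)

/-! ## Non-triviality of the centre branch strictly inside -/

/-- A regular solution of the homogeneous equations on `x ≤ −X` (`X ≥ 0`) which is non-trivial there is non-trivial at
some point `x < −X` (otherwise it vanishes at `−X − 1`, hence on `x ≤ −X` by `homogeneous_eq_zero_of_zero`). [folklore] -/
theorem exists_ne_zero_lt {r : ℝ} {W S : ℝ → ℝ} (hP : IsMonatomicProfile r W S) (hT : CavityTube r W S) {Λ : ℂ}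
    {X : ℝ} (hX : 0 ≤ X) {ŵ ŝ : ℝ → ℂ} (hreg : IsRegularPair ŵ ŝ)
    (hsol : ∀ x ∈ Iic (-X), Λ * ŵ x = linW r W S ŵ ŝ x ∧ Λ * ŝ x = linS r W S ŵ ŝ x)
    (hne : ∃ x ∈ Iic (-X), ŵ x ≠ 0 ∨ ŝ x ≠ 0) : ∃ x, x < -X ∧ (ŵ x ≠ 0 ∨ ŝ x ≠ 0) := by
  by_contra h
  push Not at h
  have hz := homogeneous_eq_zero_of_zero hP.2.2.1 hP.2.2.2.1 (noncharacteristic_of_neg hP hT) hX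
    (show -X - 1 < -X by linarith) (hreg.1.differentiable (by simp)) (hreg.2.1.differentiable (by simp)) hsol
    (h _ (by linarith)).1 (h _ (by linarith)).2
  obtain ⟨x, hx, hx'⟩ := hne
  rcases hx' with h1 | h1
  · exact h1 (hz x hx).1
  · exact h1 (hz x hx).2

end Summit.AtomisticToContinuum.HydrodynamicLimit.Theorems.SonicCavityRenewal

end
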